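import Summits.AtomisticToContinuum.BoseEinsteinCondensation.Theorems.BECHusimiAmplitudeGasLaplaceCapUnionGauss
import Summits.AtomisticToContinuum.BoseEinsteinCondensation.Theorems.BECHusimiAmplitudeGasLaplaceCapUnionGaussII
import Literature.MathematicalPhysics.QuantumManyBody.PeriodicBoseGasPQ

/-!
# Gaussian integrals over `ι → ℂ`, III: antiholomorphic forms, the Bargmann bound, cap bookkeeping

Helper file for route `BECHusimiAmplitudeGas`, support item `LaplaceCapUnion`
(stmt-AtomisticToContinuum-11995). Gaussian weight `e^{-q(c)}`, `q(c) = ∑ᵢ ‖cᵢ‖²`, on `ι → ℂ`.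

* the antiholomorphic forms `P(c) = ∑_{f : Fin N → ι} (∏ⱼ conj c_{f j}) A_f`: continuity,
  polynomial bound, homogeneity, Gaussian integrability and finiteness of `∫ e^{-q}|P|²`;
* `bargmann_lower_bound`: `∫ e^{-q} |P|² ≥ |A_{(i₀,…,i₀)}|² ∫ e^{-q} |c_{i₀}|^{2N}` (orthogonality of
  the top monomial `conj(c_{i₀})^N` to all other monomials — Bargmann 1961);
* `cap_union_core`: the `ℝ≥0∞` bookkeeping of the Laplace-principle cap union: far cap ⊆ rough-phase
  cap ∪ amplitude-far region, far mass `≤ ¼`, and the radial moment identity give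
  `(1 + N/2) ∫ e^{-q} G ≤ ∫ e^{-q} |c_{i₀}|² G` for `N ≥ 7`.
-/

noncomputable section

open MeasureTheory Set
open scoped ENNReal NNReal ComplexConjugate

namespace Summit.AtomisticToContinuum.BoseEinsteinCondensation.Theorems.LaplaceCapUnion

variable {ι : Type*} [Fintype ι]

/-! ### Antiholomorphic forms `P(c) = ∑_f (∏ⱼ conj c_{f j}) A_f` -/

section Forms

variable {N : ℕ}

omit [Fintype ι] in
/-- Each monomial term `c ↦ (∏ⱼ conj c_{f j}) A_f` is continuous. [folklore] -/
theorem continuous_form_term (A : (Fin N → ι) → ℂ) (f : Fin N → ι) :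
    Continuous fun c : ι → ℂ => (∏ j, conj (c (f j))) * A f :=
  (continuous_finsetProd _ fun j _ =>
    Complex.continuous_conj.comp (continuous_apply (f j))).mul continuous_const

/-- The form `P` is continuous. [folklore] -/
theorem continuous_form (A : (Fin N → ι) → ℂ) :
    Continuous fun c : ι → ℂ => ∑ f : Fin N → ι, (∏ j, conj (c (f j))) * A f :=
  continuous_finsetSum _ fun f _ => continuous_form_term A f

/-- `‖∏ⱼ conj c_{f j}‖ ≤ (1 + q(c))^N`. [folklore] -/
theorem norm_prod_conj_apply_le (c : ι → ℂ) (f : Fin N → ι) :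
    ‖∏ j, conj (c (f j))‖ ≤ (1 + ∑ i, ‖c i‖ ^ 2) ^ N := by
  rw [← map_prod, Complex.norm_conj]
  exact norm_prod_apply_le c f

/-- `‖(∏ⱼ conj c_{f j}) A_f‖ ≤ ‖A_f‖ (1 + q(c))^N`. [folklore] -/
theorem norm_form_term_le (A : (Fin N → ι) → ℂ) (f : Fin N → ι) (c : ι → ℂ) :
    ‖(∏ j, conj (c (f j))) * A f‖ ≤ ‖A f‖ * (1 + ∑ i, ‖c i‖ ^ 2) ^ N := by
  rw [norm_mul, mul_comm]
  exact mul_le_mul_of_nonneg_left (norm_prod_conj_apply_le c f) (norm_nonneg _)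

/-- Polynomial bound `‖P(c)‖ ≤ (∑_f ‖A_f‖) (1 + q(c))^N`. [folklore] -/
theorem norm_form_le (A : (Fin N → ι) → ℂ) (c : ι → ℂ) :
    ‖∑ f : Fin N → ι, (∏ j, conj (c (f j))) * A f‖ ≤ (∑ f : Fin N → ι, ‖A f‖) * (1 + ∑ i, ‖c i‖ ^ 2) ^ N := by
  refine (norm_sum_le _ _).trans ?_
  rw [Finset.sum_mul]
  exact Finset.sum_le_sum fun f _ => norm_form_term_le A f c

/-- `‖‖g‖²‖ ≤ C² (1+q)^{2N}` from `‖g‖ ≤ C (1+q)^N`. [folklore] -/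
theorem norm_sq_le_of_norm_le {g : (ι → ℂ) → ℂ} {C : ℝ}
    (hg : ∀ c, ‖g c‖ ≤ C * (1 + ∑ i, ‖c i‖ ^ 2) ^ N) (c : ι → ℂ) :
    ‖‖g c‖ ^ 2‖ ≤ C ^ 2 * (1 + ∑ i, ‖c i‖ ^ 2) ^ (2 * N) := by
  rw [norm_pow, norm_norm, pow_mul', ← mul_pow]
  exact pow_le_pow_left₀ (norm_nonneg _) (hg c) 2

/-- `e^{-q}|P|²` is integrable. [folklore] -/
theorem integrable_gauss_mul_norm_form_sq (A : (Fin N → ι) → ℂ) :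
    Integrable (fun c : ι → ℂ => Real.exp (-(∑ i, ‖c i‖ ^ 2)) *
      ‖∑ f : Fin N → ι, (∏ j, conj (c (f j))) * A f‖ ^ 2) :=
  integrable_gauss_mul_real_of_norm_le ((continuous_form A).norm.pow 2).aestronglyMeasurable (2 * N)
    ((∑ f : Fin N → ι, ‖A f‖) ^ 2) (norm_sq_le_of_norm_le (norm_form_le A))

/-- `∫⁻ e^{-q} ‖P‖₊² = ofReal (∫ e^{-q} ‖P‖²)`. [folklore] -/
theorem lintegral_gauss_form_sq_eq_ofReal (A : (Fin N → ι) → ℂ) :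
    ∫⁻ c : ι → ℂ, ENNReal.ofReal (Real.exp (-(∑ i, ‖c i‖ ^ 2))) *
        ((‖∑ f : Fin N → ι, (∏ j, conj (c (f j))) * A f‖₊ : ℝ≥0∞) ^ 2) =
      ENNReal.ofReal (∫ c : ι → ℂ, Real.exp (-(∑ i, ‖c i‖ ^ 2)) *
        ‖∑ f : Fin N → ι, (∏ j, conj (c (f j))) * A f‖ ^ 2) := by
  simp_rw [coe_nnnorm_pow_eq_ofReal]
  exact lintegral_gauss_mul_ofReal_eq (fun c => by positivity) (integrable_gauss_mul_norm_form_sq A)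

/-- `∫⁻ e^{-q} ‖P‖₊² < ∞`. [folklore] -/
theorem lintegral_gauss_form_sq_ne_top (A : (Fin N → ι) → ℂ) :
    ∫⁻ c : ι → ℂ, ENNReal.ofReal (Real.exp (-(∑ i, ‖c i‖ ^ 2))) *
        ((‖∑ f : Fin N → ι, (∏ j, conj (c (f j))) * A f‖₊ : ℝ≥0∞) ^ 2) ≠ ⊤ := by
  rw [lintegral_gauss_form_sq_eq_ofReal]
  exact ENNReal.ofReal_ne_top

/-- `c ↦ ‖P(c)‖₊²` is measurable. [folklore] -/
theorem measurable_nnnorm_form_sq (A : (Fin N → ι) → ℂ) :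
    Measurable fun c : ι → ℂ =>
      ((‖∑ f : Fin N → ι, (∏ j, conj (c (f j))) * A f‖₊ : ℝ≥0∞) ^ 2) :=
  ((continuous_form A).measurable.nnnorm.coe_nnreal_ennreal).pow_const 2

/-- Homogeneity: `P(t • c) = t^N P(c)` for real `t`. [folklore] -/
theorem form_smul (A : (Fin N → ι) → ℂ) (t : ℝ) (c : ι → ℂ) :
    (∑ f : Fin N → ι, (∏ j, conj ((t • c) (f j))) * A f) =
      (t : ℂ) ^ N * ∑ f : Fin N → ι, (∏ j, conj (c (f j))) * A f := by
  rw [Finset.mul_sum]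
  refine Finset.sum_congr rfl fun f _ => ?_
  simp only [Pi.smul_apply, Complex.real_smul, map_mul, Complex.conj_ofReal, Finset.prod_mul_distrib,
    Finset.prod_const, Finset.card_univ, Fintype.card_fin]
  ring

/-- Homogeneity of `‖P‖₊²` in `ℝ≥0∞`: `‖P(t • c)‖₊² = t^{2N} ‖P(c)‖₊²` (`t > 0`). [folklore] -/
theorem nnnorm_form_sq_smul (A : (Fin N → ι) → ℂ) {t : ℝ} (ht : 0 < t) (c : ι → ℂ) :
    ((‖∑ f : Fin N → ι, (∏ j, conj ((t • c) (f j))) * A f‖₊ : ℝ≥0∞) ^ 2) =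
      ENNReal.ofReal (t ^ (2 * N)) *
        ((‖∑ f : Fin N → ι, (∏ j, conj (c (f j))) * A f‖₊ : ℝ≥0∞) ^ 2) := by
  rw [form_smul, coe_nnnorm_pow_eq_ofReal, coe_nnnorm_pow_eq_ofReal, norm_mul, norm_pow,
    Complex.norm_real, Real.norm_eq_abs, abs_of_pos ht, mul_pow, ← pow_mul, mul_comm N 2,
    ENNReal.ofReal_mul (by positivity)]

end Forms

/-! ### The Bargmann lower bound -/

/-- **Bargmann lower bound.** For the antiholomorphic form `P(c) = ∑_f (∏ⱼ conj c_{f j}) A_f`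
(sum over `f : Fin N → ι`), the Gaussian `L²`-mass of `P` dominates that of its top monomial
in `c_{i₀}`: `(∫ e^{-q} |c_{i₀}|^{2N}) · |A_{(i₀,…,i₀)}|² ≤ ∫ e^{-q} |P|²` — the monomial
`conj(c_{i₀})^N` is orthogonal to every other monomial of `P` under the Gaussian
(Bargmann–Segal orthogonality of monomials). [folklore] -/
theorem bargmann_lower_bound [DecidableEq ι] (i₀ : ι) (N : ℕ) (A : (Fin N → ι) → ℂ) :
    (∫⁻ c : ι → ℂ, ENNReal.ofReal (Real.exp (-(∑ i, ‖c i‖ ^ 2))) *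
        ((‖c i₀‖₊ : ℝ≥0∞) ^ (2 * N))) * ((‖A (fun _ => i₀)‖₊ : ℝ≥0∞) ^ 2) ≤
      ∫⁻ c : ι → ℂ, ENNReal.ofReal (Real.exp (-(∑ i, ‖c i‖ ^ 2))) *
        ((‖∑ f : Fin N → ι, (∏ j, conj (c (f j))) * A f‖₊ : ℝ≥0∞) ^ 2) := by
  classical
  set f₀ : Fin N → ι := fun _ => i₀ with hf₀_def
  set P : (ι → ℂ) → ℂ := fun c => ∑ f : Fin N → ι, (∏ j, conj (c (f j))) * A f with hP_def
  set M : (ι → ℂ) → ℂ := fun c => conj (c i₀) ^ N * A f₀ with hM_def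
  set Q : (ι → ℂ) → ℂ := fun c =>
    ∑ f ∈ Finset.univ.erase f₀, (∏ j, conj (c (f j))) * A f with hQ_def
  set S : ℝ := ∑ f : Fin N → ι, ‖A f‖ with hS_def
  have hS : 0 ≤ S := Finset.sum_nonneg fun f _ => norm_nonneg _
  -- `P = M + Q`
  have hPMQ : ∀ c, P c = M c + Q c := by
    intro c
    simp only [hP_def, hM_def, hQ_def]
    rw [← Finset.add_sum_erase Finset.univ _ (Finset.mem_univ f₀)]
    congr 1
    simp only [hf₀_def, Finset.prod_const, Finset.card_univ, Fintype.card_fin]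
  have hMc : Continuous M :=
    ((Complex.continuous_conj.comp (continuous_apply i₀)).pow N).mul continuous_const
  have hQc : Continuous Q := continuous_finsetSum _ fun f _ => continuous_form_term A f
  have hpowle : ∀ c : ι → ℂ, ‖c i₀‖ ^ N ≤ (1 + ∑ i, ‖c i‖ ^ 2) ^ N := fun c =>
    pow_le_pow_left₀ (norm_nonneg _) (norm_apply_le_one_add_sum c i₀) N
  have hMle : ∀ c, ‖M c‖ ≤ ‖A f₀‖ * (1 + ∑ i, ‖c i‖ ^ 2) ^ N := by
    intro c
    simp only [hM_def, norm_mul, norm_pow, Complex.norm_conj]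
    rw [mul_comm]
    exact mul_le_mul_of_nonneg_left (hpowle c) (norm_nonneg _)
  have hQle : ∀ c, ‖Q c‖ ≤ S * (1 + ∑ i, ‖c i‖ ^ 2) ^ N := by
    intro c
    simp only [hQ_def, hS_def]
    refine (norm_sum_le _ _).trans ?_
    rw [Finset.sum_mul]
    refine (Finset.sum_le_sum fun f _ => norm_form_term_le A f c).trans ?_
    exact Finset.sum_le_univ_sum_of_nonneg fun f => by positivity
  -- integrability
  have IP : Integrable (fun c : ι → ℂ => Real.exp (-(∑ i, ‖c i‖ ^ 2)) * ‖P c‖ ^ 2) :=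
    integrable_gauss_mul_norm_form_sq A
  have IM : Integrable (fun c : ι → ℂ => Real.exp (-(∑ i, ‖c i‖ ^ 2)) * ‖M c‖ ^ 2) :=
    integrable_gauss_mul_real_of_norm_le (hMc.norm.pow 2).aestronglyMeasurable (2 * N)
      (‖A f₀‖ ^ 2) (norm_sq_le_of_norm_le hMle)
  have IQ : Integrable (fun c : ι → ℂ => Real.exp (-(∑ i, ‖c i‖ ^ 2)) * ‖Q c‖ ^ 2) :=
    integrable_gauss_mul_real_of_norm_le (hQc.norm.pow 2).aestronglyMeasurable (2 * N) (S ^ 2)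
      (norm_sq_le_of_norm_le hQle)
  have IX : Integrable (fun c : ι → ℂ =>
      (Real.exp (-(∑ i, ‖c i‖ ^ 2)) : ℂ) * (conj (M c) * Q c)) := by
    refine integrable_gauss_mul_of_norm_le
      ((Complex.continuous_conj.comp hMc).mul hQc).aestronglyMeasurable (2 * N) (‖A f₀‖ * S) ?_
    intro c
    rw [norm_mul, Complex.norm_conj, pow_mul', sq, mul_mul_mul_comm]
    exact mul_le_mul (hMle c) (hQle c) (norm_nonneg _) (by positivity)
  have I0 : Integrable (fun c : ι → ℂ => Real.exp (-(∑ i, ‖c i‖ ^ 2)) * ‖c i₀‖ ^ (2 * N)) := by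
    refine integrable_gauss_mul_real_of_norm_le (Continuous.aestronglyMeasurable (by fun_prop))
      (2 * N) 1 fun c => ?_
    rw [norm_pow, norm_norm, one_mul]
    calc ‖c i₀‖ ^ (2 * N) = (‖c i₀‖ ^ N) ^ 2 := by ring
      _ ≤ ((1 + ∑ i, ‖c i‖ ^ 2) ^ N) ^ 2 := pow_le_pow_left₀ (by positivity) (hpowle c) 2
      _ = (1 + ∑ i, ‖c i‖ ^ 2) ^ (2 * N) := by ring
  -- the cross term vanishes
  have Iterm : ∀ f : Fin N → ι, Integrable (fun c : ι → ℂ =>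
      (Real.exp (-(∑ i, ‖c i‖ ^ 2)) : ℂ) * (c i₀ ^ N * conj (∏ j, c (f j)))) := by
    intro f
    refine integrable_gauss_mul_of_norm_le (Continuous.aestronglyMeasurable ?_) (2 * N) 1 ?_
    · exact ((continuous_apply i₀).pow N).mul
        (Complex.continuous_conj.comp (continuous_finsetProd _ fun j _ => continuous_apply (f j)))
    · intro c
      rw [norm_mul, norm_pow, Complex.norm_conj, one_mul, pow_mul', sq]
      exact mul_le_mul (hpowle c) (norm_prod_apply_le c f) (norm_nonneg _) (by positivity)
  have hcross : ∫ c : ι → ℂ, (Real.exp (-(∑ i, ‖c i‖ ^ 2)) : ℂ) * (conj (M c) * Q c) = 0 := by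
    have hexp : ∀ c : ι → ℂ, (Real.exp (-(∑ i, ‖c i‖ ^ 2)) : ℂ) * (conj (M c) * Q c) =
        ∑ f ∈ Finset.univ.erase f₀, (conj (A f₀) * A f) *
          ((Real.exp (-(∑ i, ‖c i‖ ^ 2)) : ℂ) * (c i₀ ^ N * conj (∏ j, c (f j)))) := by
      intro c
      simp only [hM_def, hQ_def, Finset.mul_sum]
      refine Finset.sum_congr rfl fun f _ => ?_
      rw [map_mul, map_pow, Complex.conj_conj, ← map_prod]
      ring
    simp_rw [hexp]
    rw [integral_finsetSum _ fun f _ => (Iterm f).const_mul _]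
    refine Finset.sum_eq_zero fun f hf => ?_
    rw [integral_const_mul, integral_gauss_pow_mul_conj_prod_eq_zero i₀ (Finset.ne_of_mem_erase hf),
      mul_zero]
  have IXre : Integrable (fun c : ι → ℂ =>
      Real.exp (-(∑ i, ‖c i‖ ^ 2)) * (conj (M c) * Q c).re) := by
    refine IX.re.congr (Filter.Eventually.of_forall fun c => ?_)
    simp only [RCLike.re_to_complex, Complex.re_ofReal_mul]
  have hre0 : ∫ c : ι → ℂ, Real.exp (-(∑ i, ‖c i‖ ^ 2)) * (conj (M c) * Q c).re = 0 := by
    have h1 : ∫ c : ι → ℂ, Real.exp (-(∑ i, ‖c i‖ ^ 2)) * (conj (M c) * Q c).re =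
        ∫ c : ι → ℂ, RCLike.re ((Real.exp (-(∑ i, ‖c i‖ ^ 2)) : ℂ) * (conj (M c) * Q c)) :=
      integral_congr_ae (Filter.Eventually.of_forall fun c => by
        simp only [RCLike.re_to_complex, Complex.re_ofReal_mul])
    rw [h1, integral_re IX, hcross, map_zero]
  -- `∫ e^{-q}|P|² = ∫ e^{-q}|M|² + ∫ e^{-q}|Q|²`
  have hsplit : ∫ c : ι → ℂ, Real.exp (-(∑ i, ‖c i‖ ^ 2)) * ‖P c‖ ^ 2 =
      (∫ c : ι → ℂ, Real.exp (-(∑ i, ‖c i‖ ^ 2)) * ‖M c‖ ^ 2) +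
        ∫ c : ι → ℂ, Real.exp (-(∑ i, ‖c i‖ ^ 2)) * ‖Q c‖ ^ 2 := by
    have hpt : ∀ c : ι → ℂ, Real.exp (-(∑ i, ‖c i‖ ^ 2)) * ‖P c‖ ^ 2 =
        (Real.exp (-(∑ i, ‖c i‖ ^ 2)) * ‖M c‖ ^ 2 + Real.exp (-(∑ i, ‖c i‖ ^ 2)) * ‖Q c‖ ^ 2) +
          2 * (Real.exp (-(∑ i, ‖c i‖ ^ 2)) * (conj (M c) * Q c).re) := by
      intro c
      rw [hPMQ, Literature.MathematicalPhysics.QuantumManyBody.BoseGas.norm_add_sq_complex]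
      ring
    have IMQ : Integrable (fun c : ι → ℂ =>
        Real.exp (-(∑ i, ‖c i‖ ^ 2)) * ‖M c‖ ^ 2 + Real.exp (-(∑ i, ‖c i‖ ^ 2)) * ‖Q c‖ ^ 2) :=
      IM.add IQ
    have IX2 : Integrable (fun c : ι → ℂ =>
        2 * (Real.exp (-(∑ i, ‖c i‖ ^ 2)) * (conj (M c) * Q c).re)) := IXre.const_mul 2
    simp_rw [hpt]
    rw [integral_add IMQ IX2, integral_add IM IQ, integral_const_mul, hre0, mul_zero, add_zero]
  have hMval : ∫ c : ι → ℂ, Real.exp (-(∑ i, ‖c i‖ ^ 2)) * ‖M c‖ ^ 2 =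
      (∫ c : ι → ℂ, Real.exp (-(∑ i, ‖c i‖ ^ 2)) * ‖c i₀‖ ^ (2 * N)) * ‖A f₀‖ ^ 2 := by
    rw [← integral_mul_const]
    refine integral_congr_ae (Filter.Eventually.of_forall fun c => ?_)
    simp only [hM_def, norm_mul, norm_pow, Complex.norm_conj]
    ring
  have hreal : (∫ c : ι → ℂ, Real.exp (-(∑ i, ‖c i‖ ^ 2)) * ‖c i₀‖ ^ (2 * N)) * ‖A f₀‖ ^ 2 ≤
      ∫ c : ι → ℂ, Real.exp (-(∑ i, ‖c i‖ ^ 2)) * ‖P c‖ ^ 2 := by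
    rw [← hMval, hsplit]
    exact le_add_of_nonneg_right (integral_nonneg fun c => by positivity)
  -- back to `ℝ≥0∞`
  have hL : (∫⁻ c : ι → ℂ, ENNReal.ofReal (Real.exp (-(∑ i, ‖c i‖ ^ 2))) *
      ((‖c i₀‖₊ : ℝ≥0∞) ^ (2 * N))) * ((‖A f₀‖₊ : ℝ≥0∞) ^ 2) =
      ENNReal.ofReal ((∫ c : ι → ℂ, Real.exp (-(∑ i, ‖c i‖ ^ 2)) * ‖c i₀‖ ^ (2 * N)) *
        ‖A f₀‖ ^ 2) := by
    simp_rw [coe_nnnorm_pow_eq_ofReal]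
    rw [lintegral_gauss_mul_ofReal_eq (fun c => by positivity) I0,
      ← ENNReal.ofReal_mul (integral_nonneg fun c => by positivity)]
  rw [hL, lintegral_gauss_form_sq_eq_ofReal]
  exact ENNReal.ofReal_le_ofReal hreal

/-! ### The cap-union bookkeeping in `ℝ≥0∞` -/

/-- **Cap-union bookkeeping.** Abstract form of the Laplace-principle glue on `ι → ℂ` with the
Gaussian weight `w = e^{-q}`: let `G ≥ 0` be measurable and homogeneous of degree `2N`
(`N ≥ 7`), `G ≤ Gabs`, `‖ov'(c)‖ = ‖c_{i₀}‖`; if the far cap `{‖ov'‖² ≤ ¾ q}` is covered by the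
weights `χP + χA ≥ 1`, the two cap masses satisfy `∫ w χP G ≤ ⅛ ∫ w G` and
`∫ w χA Gabs ≤ ⅛ X Y` with `X Y ≤ ∫ w G < ∞`, then `(1 + N/2) ∫ w G ≤ ∫ w ‖ov'‖² G`.
Proof: far mass `≤ ¼ ∫ w G`, so the near cone carries `≥ ¾`; on it `‖c_{i₀}‖² > ¾ q`, and the
radial moment identity `∫ q w G_near = (N + |ι|) ∫ w G_near` gives the factor
`(9/16)(N + |ι|) ≥ 1 + N/2`. [folklore] -/
theorem cap_union_core [Nonempty ι] {i₀ : ι} {N : ℕ}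
    {G Gabs χP χA : (ι → ℂ) → ℝ≥0∞} {ov' : (ι → ℂ) → ℂ} {X Y : ℝ≥0∞}
    (hP : ∫⁻ c : ι → ℂ, ENNReal.ofReal (Real.exp (-(∑ i, ‖c i‖ ^ 2))) * χP c * G c ≤
      1 / 8 * ∫⁻ c : ι → ℂ, ENNReal.ofReal (Real.exp (-(∑ i, ‖c i‖ ^ 2))) * G c)
    (hA : ∫⁻ c : ι → ℂ, ENNReal.ofReal (Real.exp (-(∑ i, ‖c i‖ ^ 2))) * χA c * Gabs c ≤
      1 / 8 * X * Y)
    (hN : 7 ≤ N) (hGm : Measurable G)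
    (hom : ∀ t : ℝ, 0 < t → ∀ c, G (t • c) = ENNReal.ofReal (t ^ (2 * N)) * G c)
    (hGabs : ∀ c, G c ≤ Gabs c) (hχPm : Measurable χP) (hov : ∀ c, ‖ov' c‖ = ‖c i₀‖)
    (hcover : ∀ c : ι → ℂ, ‖ov' c‖ ^ 2 ≤ 3 / 4 * ∑ i, ‖c i‖ ^ 2 → 1 ≤ χP c + χA c)
    (hBarg : X * Y ≤ ∫⁻ c : ι → ℂ, ENNReal.ofReal (Real.exp (-(∑ i, ‖c i‖ ^ 2))) * G c)
    (hfin : ∫⁻ c : ι → ℂ, ENNReal.ofReal (Real.exp (-(∑ i, ‖c i‖ ^ 2))) * G c ≠ ⊤) :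
    ENNReal.ofReal (1 + (N : ℝ) / 2) *
        (∫⁻ c : ι → ℂ, ENNReal.ofReal (Real.exp (-(∑ i, ‖c i‖ ^ 2))) * G c) ≤
      ∫⁻ c : ι → ℂ, ENNReal.ofReal (Real.exp (-(∑ i, ‖c i‖ ^ 2))) *
        ((‖ov' c‖₊ : ℝ≥0∞) ^ 2) * G c := by
  set w : (ι → ℂ) → ℝ≥0∞ := fun c => ENNReal.ofReal (Real.exp (-(∑ i, ‖c i‖ ^ 2))) with hw_def
  have hwm : Measurable w := measurable_gauss_one
  set I : ℝ≥0∞ := ∫⁻ c, w c * G c with hI_def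
  -- the near cone and the restricted density
  set near : Set (ι → ℂ) := {c | 3 / 4 * ∑ i, ‖c i‖ ^ 2 < ‖c i₀‖ ^ 2} with hnear_def
  have hnear_meas : MeasurableSet near :=
    measurableSet_lt (by fun_prop) (by fun_prop)
  set Gn : (ι → ℂ) → ℝ≥0∞ := near.indicator G with hGn_def
  have hGn_meas : Measurable Gn := hGm.indicator hnear_meas
  have hGn_hom : ∀ t : ℝ, 0 < t → ∀ c, Gn (t • c) = ENNReal.ofReal (t ^ (2 * N)) * Gn c := by
    intro t ht c
    have hmem : t • c ∈ near ↔ c ∈ near := by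
      simp only [hnear_def, Set.mem_setOf_eq]
      rw [sum_norm_sq_smul, Pi.smul_apply, norm_smul, Real.norm_eq_abs, abs_of_pos ht, mul_pow,
        mul_left_comm]
      exact mul_lt_mul_iff_of_pos_left (show (0 : ℝ) < t ^ 2 by positivity)
    by_cases hc : c ∈ near
    · rw [hGn_def, Set.indicator_of_mem (hmem.2 hc), Set.indicator_of_mem hc, hom t ht c]
    · rw [hGn_def, Set.indicator_of_notMem (mt hmem.1 hc), Set.indicator_of_notMem hc, mul_zero]
  -- (a) the right-hand side dominates `¾ ∫ q w Gn`
  have ha : 3 / 4 * ∫⁻ c, ENNReal.ofReal (∑ i, ‖c i‖ ^ 2) * (w c * Gn c) ≤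
      ∫⁻ c, w c * ((‖ov' c‖₊ : ℝ≥0∞) ^ 2) * G c := by
    rw [← lintegral_const_mul' _ _ (by rw [three_div_four_eq_ofReal]; exact ENNReal.ofReal_ne_top)]
    refine lintegral_mono fun c => ?_
    by_cases hc : c ∈ near
    · rw [hGn_def, Set.indicator_of_mem hc]
      have h1 : (3 / 4 : ℝ≥0∞) * ENNReal.ofReal (∑ i, ‖c i‖ ^ 2) ≤ (‖ov' c‖₊ : ℝ≥0∞) ^ 2 := by
        rw [coe_nnnorm_pow_eq_ofReal, hov c, three_div_four_eq_ofReal,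
          ← ENNReal.ofReal_mul (by norm_num)]
        exact ENNReal.ofReal_le_ofReal (le_of_lt hc)
      calc 3 / 4 * (ENNReal.ofReal (∑ i, ‖c i‖ ^ 2) * (w c * G c))
          = (3 / 4 * ENNReal.ofReal (∑ i, ‖c i‖ ^ 2)) * w c * G c := by ring
        _ ≤ (‖ov' c‖₊ : ℝ≥0∞) ^ 2 * w c * G c := by gcongr
        _ = w c * (‖ov' c‖₊ : ℝ≥0∞) ^ 2 * G c := by ring
    · rw [hGn_def, Set.indicator_of_notMem hc]
      simp
  -- (b) far mass `≤ ¼ I`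
  have h18 : (1 / 8 : ℝ≥0∞) + 1 / 8 = 1 / 4 := by
    rw [one_div_eight_eq_ofReal, ← ENNReal.ofReal_add (by norm_num) (by norm_num),
      show (1 / 8 : ℝ) + 1 / 8 = 1 / 4 by norm_num, ENNReal.ofReal_div_of_pos (by norm_num),
      ENNReal.ofReal_one, ENNReal.ofReal_ofNat]
  have hfar_le : ∫⁻ c, w c * nearᶜ.indicator G c ≤ 1 / 4 * I := by
    have hpt : ∀ c, w c * nearᶜ.indicator G c ≤ w c * χP c * G c + w c * χA c * Gabs c := by
      intro c
      by_cases hc : c ∈ nearᶜ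
      · rw [Set.indicator_of_mem hc]
        have hfar : ‖ov' c‖ ^ 2 ≤ 3 / 4 * ∑ i, ‖c i‖ ^ 2 := by
          rw [hov c]
          simpa [hnear_def] using hc
        calc w c * G c = w c * G c * 1 := (mul_one _).symm
          _ ≤ w c * G c * (χP c + χA c) := by gcongr; exact hcover c hfar
          _ = w c * χP c * G c + w c * χA c * G c := by ring
          _ ≤ w c * χP c * G c + w c * χA c * Gabs c := by gcongr; exact hGabs c
      · rw [Set.indicator_of_notMem hc, mul_zero]
        exact bot_le
    calc ∫⁻ c, w c * nearᶜ.indicator G c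
        ≤ ∫⁻ c, (w c * χP c * G c + w c * χA c * Gabs c) := lintegral_mono hpt
      _ = (∫⁻ c, w c * χP c * G c) + ∫⁻ c, w c * χA c * Gabs c :=
          lintegral_add_left ((hwm.mul hχPm).mul hGm) _
      _ ≤ 1 / 8 * I + 1 / 8 * X * Y := add_le_add hP hA
      _ ≤ 1 / 8 * I + 1 / 8 * I := by rw [mul_assoc]; gcongr
      _ = 1 / 4 * I := by rw [← add_mul, h18]
  -- (c) `I ≤ ∫ w Gn + far mass`, hence `¾ I ≤ ∫ w Gn`
  have hsplitI : I ≤ (∫⁻ c, w c * Gn c) + ∫⁻ c, w c * nearᶜ.indicator G c := by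
    have hm2 : Measurable fun c => w c * Gn c := hwm.mul hGn_meas
    rw [← lintegral_add_left hm2]
    refine lintegral_mono fun c => le_of_eq ?_
    rw [hGn_def, ← mul_add, ← Pi.add_apply (near.indicator G), Set.indicator_self_add_compl]
  have h3414 : (3 / 4 : ℝ≥0∞) + 1 / 4 = 1 := by
    rw [three_div_four_eq_ofReal, ENNReal.ofReal_div_of_pos (by norm_num : (0:ℝ) < 4)]
    rw [ENNReal.ofReal_ofNat, ENNReal.ofReal_ofNat, ENNReal.div_add_div_same]
    norm_num
    exact ENNReal.div_self (by norm_num) (by norm_num)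
  have hquarter : (1 / 4 : ℝ≥0∞) * I ≠ ⊤ :=
    ENNReal.mul_ne_top (by rw [one_div]; exact ENNReal.inv_ne_top.2 (by norm_num)) hfin
  have h34 : 3 / 4 * I ≤ ∫⁻ c, w c * Gn c := by
    refine ENNReal.le_of_add_le_add_right hquarter ?_
    calc 3 / 4 * I + 1 / 4 * I = I := by rw [← add_mul, h3414, one_mul]
      _ ≤ (∫⁻ c, w c * Gn c) + ∫⁻ c, w c * nearᶜ.indicator G c := hsplitI
      _ ≤ (∫⁻ c, w c * Gn c) + 1 / 4 * I := add_le_add le_rfl hfar_le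
  -- (d) the radial moment identity and the constants
  have hrad := lintegral_sum_norm_sq_mul_gauss Gn hGn_meas N hGn_hom
  have hcard : (1 : ℝ) ≤ Fintype.card ι := by exact_mod_cast Fintype.card_pos (α := ι)
  have hN' : (7 : ℝ) ≤ N := by exact_mod_cast hN
  have hconst : ENNReal.ofReal (1 + (N : ℝ) / 2) ≤
      3 / 4 * ((N : ℝ≥0∞) + Fintype.card ι) * (3 / 4) := by
    have : (3 / 4 : ℝ≥0∞) * ((N : ℝ≥0∞) + Fintype.card ι) * (3 / 4) =
        ENNReal.ofReal (3 / 4 * ((N : ℝ) + Fintype.card ι) * (3 / 4)) := by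
      rw [ENNReal.ofReal_mul (by positivity), ENNReal.ofReal_mul (by positivity),
        ENNReal.ofReal_add (by positivity) (by positivity), ENNReal.ofReal_natCast,
        ENNReal.ofReal_natCast, three_div_four_eq_ofReal]
    rw [this]
    exact ENNReal.ofReal_le_ofReal (by nlinarith)
  calc ENNReal.ofReal (1 + (N : ℝ) / 2) * I
      ≤ (3 / 4 * ((N : ℝ≥0∞) + Fintype.card ι) * (3 / 4)) * I := by gcongr
    _ = 3 / 4 * (((N : ℝ≥0∞) + Fintype.card ι) * (3 / 4 * I)) := by ring
    _ ≤ 3 / 4 * (((N : ℝ≥0∞) + Fintype.card ι) * ∫⁻ c, w c * Gn c) := by gcongr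
    _ = 3 / 4 * ∫⁻ c, ENNReal.ofReal (∑ i, ‖c i‖ ^ 2) * (w c * Gn c) := by rw [hrad]
    _ ≤ ∫⁻ c, w c * ((‖ov' c‖₊ : ℝ≥0∞) ^ 2) * G c := ha

end Summit.AtomisticToContinuum.BoseEinsteinCondensation.Theorems.LaplaceCapUnion
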